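/-
Soloist `solo-ValiantsHypothesis-informed`, session 5 — the Boolean-cube sibling of the
univariate reduction.
-/
import Mathlib
import Summits.ValiantsHypothesis.ValiantsHypothesis.Theorems.SoloInformedQuadSpanReduction

/-!
# A Boolean-cube reduction of `VP ≠ VNP` (solo seat `solo-ValiantsHypothesis-informed`, s5)

Kernel form of §2.6 of the soloist's note `paper/quadspan.md`.  The univariate reduction
(`SoloInformedQuadSpanReduction.lean`) restricts a putative degree-2 cover `Γ : ℂˢ → ℂᵐ` of the
design map `f_S = (∏_{r ∈ S_i} x_r)_i` to the monomial curve `x_r = z^{D^r}`; this file restricts it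
instead to the BOOLEAN CUBE `{±1}ⁿ ⊂ ℂⁿ`, where the coordinates of `f_S` become the parity
(Walsh) functions `χ_{S_i}`.  Non-elusiveness is pointwise image containment (Raz 2010, Def. 1.1),
so no symbolic lemma is needed: choosing a preimage `v(x) ∈ ℂˢ` of `f_S(x)` for every
`x ∈ {±1}ⁿ` gives `s` complex-valued functions `v_1, …, v_s` on the cube such that EVERY parity
`χ_{S_i}` (`i ≤ m`) agrees on the whole cube with a polynomial of degree `≤ 2` in `v_1, …, v_s`.

* `SoloBoolQuadSpanBound K h` — HYPOTHESIS-CARRYING structure (nothing here constructs a useful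
  one): a function `Q` with "if the `m` parities of a `(K, h)`-sign-independent family of subsets
  of `Fin n` all lie in the quadratic span of `s` functions `{±1}ⁿ → ℂ`, then `m ≤ Q s`".
  Conjecture Q^𝔹 of the note: one exists with `Q s ≤ C s^γ`, `γ < 3/2` (monomial = "sumset"
  examples show `γ ≥ 1 + 1/⌊K/2⌋` is necessary, so `K ≥ 6`).
* `solo_restrict_of_not_isElusive` — the move in general: a non-elusive map restricted to ANY
  family of points yields functions realising its coordinates in a degree-`r` span.
* `soloInformed_isElusive_designMap_of_bool` — THE REDUCTION: `B.Q s < m` ⟹ the design map is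
  `(s, 2)`-elusive.
* `soloInformed_vp_ne_vnp_of_boolQuadSpanBound(_cor58)` — with explicit designs
  (`SoloInformedRSDesign.lean`), Raz's side conditions and poly-definability (hypothesis `hdef`),
  a Boolean bound structure gives `VP ℂ ≠ VNP ℂ` (Raz 2010, §1 result 1 / Cor. 5.8).
* `soloInformed_boolQuadSpanBound_trivial` — NON-VACUITY / calibration: the structure is
  inhabited with `Q s` = the number of monomials of degree `≤ 2` in `s` variables
  (`= C(s+2, 2)`), because distinct parities are linearly independent.  The summit needs
  `s^{3/2 - ε}`; the trivial instance is `≍ s²/2`.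

References: R. Raz, Theory of Computing 6 (2010) 135–177, §1 result 1, Cor. 5.8, Defs. 1.1, 1.3.
-/

noncomputable section

open MvPolynomial Finset

namespace Summit.ValiantsHypothesis.ValiantsHypothesis.Theorems

open Literature.Computability.AlgebraicComplexity

/-! ### The cube, parities, and the restriction principle -/

/-- The sign `±1 ∈ ℂ` attached to a Boolean value (`true ↦ -1`). -/
def soloSign (b : Bool) : ℂ := if b then -1 else 1

/-- `(±1)² = 1`. -/
@[simp] theorem soloSign_mul_self (b : Bool) : soloSign b * soloSign b = 1 := by
  unfold soloSign; split <;> norm_num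

/-- `±1 ≠ 0`. -/
theorem soloSign_ne_zero (b : Bool) : soloSign b ≠ 0 := by
  unfold soloSign; split <;> norm_num

/-- Flipping the Boolean value flips the sign. -/
@[simp] theorem soloSign_not (b : Bool) : soloSign (!b) = - soloSign b := by
  unfold soloSign; cases b <;> simp

/-- The point of `ℂⁿ` with coordinates `±1` attached to `x ∈ {0,1}ⁿ`. -/
def soloCubePoint {n : ℕ} (x : Fin n → Bool) : Fin n → ℂ := fun r => soloSign (x r)

/-- The parity (Walsh) function `χ_S(x) = ∏_{r ∈ S} (±1)_r` on the cube. -/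
def soloParity {n : ℕ} (S : Finset (Fin n)) (x : Fin n → Bool) : ℂ := ∏ r ∈ S, soloSign (x r)

/-- On the cube the `i`-th design monomial is the parity of `S i`. -/
theorem solo_eval_designMap_cube {m n : ℕ} (S : Fin m → Finset (Fin n)) (x : Fin n → Bool)
    (i : Fin m) : eval (soloCubePoint x) (soloDesignMap S i) = soloParity (S i) x := by
  simp [soloDesignMap, soloParity, soloCubePoint, map_prod, eval_X]

/-- **Restriction principle.** If `f` is not `(s, r)`-elusive, then for ANY family of points
`p : X → ℂ^σ` there are a degree-`≤ r` map `Γ` and functions `v : X → ℂˢ` with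
`Γ_i(v(x)) = f_i(p(x))` for all `x` and `i`. [cite: Raz2010, Def. 1.1] -/
theorem solo_restrict_of_not_isElusive {ι σ X : Type*} {f : ι → MvPolynomial σ ℂ} {s r : ℕ}
    (h : ¬ IsElusive f s r) (p : X → σ → ℂ) :
    ∃ Γ : ι → MvPolynomial (Fin s) ℂ, (∀ i, (Γ i).totalDegree ≤ r) ∧
      ∃ v : X → Fin s → ℂ, ∀ x i, eval (v x) (Γ i) = eval (p x) (f i) := by
  classical
  unfold IsElusive at h
  push Not at h
  obtain ⟨Γ, hΓ, hsub⟩ := h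
  have hx : ∀ x : X, ∃ y : Fin s → ℂ, polyMapEval Γ y = polyMapEval f (p x) :=
    fun x => Set.mem_range.1 (hsub (Set.mem_range_self (p x)))
  choose v hv using hx
  exact ⟨Γ, hΓ, v, fun x i => by simpa [polyMapEval_apply] using congr_fun (hv x) i⟩

/-! ### The Boolean bound structure and the reduction -/

/-- **A bound function for the Boolean-cube problem, bundled with its defining property** (a
HYPOTHESIS wherever it occurs; Conjecture Q^𝔹 of the note asserts one exists with
`Q s = O(s^γ)`, `γ < 3/2`).  `bound`: if `S` is a `(K, h)`-sign-independent family of `m` subsets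
of `Fin n` and `v : {0,1}ⁿ → ℂˢ` is such that every parity `χ_{S i}` agrees on the whole cube with
`x ↦ Γ_i(v(x))` for some `Γ_i` of total degree `≤ 2`, then `m ≤ Q s`. -/
structure SoloBoolQuadSpanBound (K h : ℕ) where
  /-- the bound, as a function of the number `s` of functions on the cube -/
  Q : ℕ → ℕ
  /-- sign-independent parity families realised inside a quadratic span of `s` functions have at
  most `Q s` members -/
  bound : ∀ (n m s : ℕ) (S : SoloDesign K h m n) (v : (Fin n → Bool) → Fin s → ℂ),
    (∀ i : Fin m, ∃ Γ : MvPolynomial (Fin s) ℂ, Γ.totalDegree ≤ 2 ∧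
        ∀ x : Fin n → Bool, eval (v x) Γ = soloParity (S.S i) x) →
      m ≤ Q s

/-- **Boolean quad-span bound ⇒ elusive design maps.** For a `(K, h)`-design `S` of `m` sets and
a Boolean bound structure `B` with `B.Q s < m`, the monomial map of `S` is `(s, 2)`-elusive over
`ℂ` (Raz 2010, Def. 1.1): restrict a cover to the cube `{±1}ⁿ`. [cite: Raz2010, Def. 1.1] -/
theorem soloInformed_isElusive_designMap_of_bool {K h m n : ℕ} (S : SoloDesign K h m n)
    (B : SoloBoolQuadSpanBound K h) {s : ℕ} (hm : B.Q s < m) :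
    IsElusive (soloDesignMap S.S) s 2 := by
  by_contra hne
  obtain ⟨Γ, hΓ, v, hv⟩ := solo_restrict_of_not_isElusive hne (soloCubePoint (n := n))
  have hb := B.bound n m s S v fun i => ⟨Γ i, hΓ i, fun x => by
    rw [hv x i, solo_eval_designMap_cube]⟩
  omega

/-- **Boolean bound + explicit designs ⇒ `VP ℂ ≠ VNP ℂ`** through Raz 2010, §1 result 1 (tree
theorem `Raz2010_result_1_holds`): `(K, h)`-designs `S n` of `m n = n^{ω(1)}` subsets of `Fin n`,
`m n ^ 9 ≤ s n ^ 10` and `B.Q (s n) < m n` eventually, and poly(`n`)-definability of the design map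
(hypothesis `hdef`). [cite: Raz2010, §1 result 1, Defs. 1.1, 1.3] -/
theorem soloInformed_vp_ne_vnp_of_boolQuadSpanBound {K h : ℕ} (B : SoloBoolQuadSpanBound K h)
    {m s : ℕ → ℕ} (S : ∀ n, SoloDesign K h (m n) n)
    (hm : ∀ c : ℕ, ∃ n₀ : ℕ, ∀ n ≥ n₀, n ^ c ≤ m n)
    (hs : ∃ n₀ : ℕ, ∀ n ≥ n₀, m n ^ 9 ≤ s n ^ 10)
    (hQm : ∃ n₀ : ℕ, ∀ n ≥ n₀, B.Q (s n) < m n)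
    (hdef : IsPolyDefinableMap (m := m) (σ := fun n => Fin n) fun n => soloDesignMap (S n).S) :
    VP ℂ ≠ VNP ℂ := by
  refine perNotPComputableComplex_iff_holds.mp ?_
  have hdeg : IsPBounded
      (fun n => Finset.univ.sup fun i : Fin (m n) => (soloDesignMap (S n).S i).totalDegree) :=
    IsPBounded.id.mono fun n => Finset.sup_le fun i _ => solo_totalDegree_designMap_le (S n).S i
  have hel : ∃ n₀ : ℕ, ∀ n ≥ n₀, IsElusive (soloDesignMap (S n).S) (s n) 2 := by
    obtain ⟨n₀, h0⟩ := hQm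
    exact ⟨n₀, fun n hn => soloInformed_isElusive_designMap_of_bool (S n) B (h0 n hn)⟩
  exact Raz2010_result_1_holds ℂ ringChar_complex_ne_two m s (fun n => soloDesignMap (S n).S)
    hm hs hdef hdeg hel

/-- **The same reduction through Raz 2010, Cor. 5.8 (= Cor. 1.14), with `r = r(n)` free** — the
form in which the Boolean bound is needed only with SOME exponent `γ < 3/2`.
[cite: Raz2010, Cor. 5.8 = Cor. 1.14, Defs. 1.1, 1.3] -/
theorem soloInformed_vp_ne_vnp_of_boolQuadSpanBound_cor58 {K h : ℕ} (B : SoloBoolQuadSpanBound K h)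
    {r s : ℕ → ℕ} (S : ∀ n, SoloDesign K h (Nat.choose (n + r n - 1) (r n)) n)
    (hpar : ∃ n₀ : ℕ, ∀ n ≥ n₀, 3 ≤ r n ∧ r n ≤ n ∧ n ≤ s n)
    (hgrow : ∀ c : ℕ, ∃ n₀ : ℕ, ∀ n ≥ n₀,
      n ^ c * Nat.choose (n + 2 * r n / 3 - 1) (2 * r n / 3) ≤ s n)
    (hQm : ∃ n₀ : ℕ, ∀ n ≥ n₀, B.Q (s n) < Nat.choose (n + r n - 1) (r n))
    (hdef : IsPolyDefinableMap (m := fun n => Nat.choose (n + r n - 1) (r n))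
      (σ := fun n => Fin n) fun n => soloDesignMap (S n).S) :
    VP ℂ ≠ VNP ℂ := by
  refine perNotPComputableComplex_iff_holds.mp ?_
  have hel : ∃ n₀ : ℕ, ∀ n ≥ n₀, ∃ (G : Type) (_ : Field G) (_ : Algebra ℂ G),
      IsElusive (fun i => MvPolynomial.map (algebraMap ℂ G) (soloDesignMap (S n).S i))
        (s n) 2 := by
    obtain ⟨n₀, h0⟩ := hQm
    refine ⟨n₀, fun n hn => ⟨ℂ, inferInstance, inferInstance, ?_⟩⟩
    have hid : (fun i => MvPolynomial.map (algebraMap ℂ ℂ) (soloDesignMap (S n).S i))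
        = soloDesignMap (S n).S := by
      funext i
      rw [Algebra.algebraMap_self, MvPolynomial.map_id]
    rw [hid]
    exact soloInformed_isElusive_designMap_of_bool (S n) B (h0 n hn)
  exact Raz2010_cor_5_8_holds ℂ ringChar_complex_ne_two r s (fun n => soloDesignMap (S n).S)
    hpar hgrow hdef hel

/-! ### Non-vacuity: distinct parities are linearly independent, so `m ≤ dim ℂ[y_1..y_s]_{≤ 2}` -/

section Parity

variable {n : ℕ}

/-- `χ_S² = 1`. -/
theorem soloParity_mul_self (S : Finset (Fin n)) (x : Fin n → Bool) :
    soloParity S x * soloParity S x = 1 := by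
  rw [soloParity, ← Finset.prod_mul_distrib]
  simp

/-- `χ_S · χ_T = χ_{S Δ T}`. -/
theorem soloParity_mul (S T : Finset (Fin n)) (x : Fin n → Bool) :
    soloParity S x * soloParity T x = soloParity (S \ T ∪ T \ S) x := by
  classical
  have hS := Finset.prod_sdiff (s₁ := S ∩ T) (s₂ := S) (f := fun r => soloSign (x r))
    Finset.inter_subset_left
  have hT := Finset.prod_sdiff (s₁ := S ∩ T) (s₂ := T) (f := fun r => soloSign (x r))
    Finset.inter_subset_right
  rw [Finset.sdiff_inter_self_left] at hS
  rw [Finset.sdiff_inter_self_right] at hT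
  have h1 : (∏ r ∈ S ∩ T, soloSign (x r)) * ∏ r ∈ S ∩ T, soloSign (x r) = 1 := by
    rw [← Finset.prod_mul_distrib]; simp
  unfold soloParity
  rw [Finset.prod_union disjoint_sdiff_sdiff, ← hS, ← hT]
  linear_combination (∏ r ∈ S \ T, soloSign (x r)) * (∏ r ∈ T \ S, soloSign (x r)) * h1

/-- A nontrivial parity sums to zero over the cube (flip one coordinate of `U`). -/
theorem solo_sum_parity_eq_zero {U : Finset (Fin n)} (hU : U.Nonempty) :
    ∑ x : Fin n → Bool, soloParity U x = 0 := by
  classical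
  obtain ⟨r, hr⟩ := hU
  let φ : (Fin n → Bool) → (Fin n → Bool) := fun x => Function.update x r (!x r)
  have hinv : Function.Involutive φ := by
    intro x; funext t; by_cases ht : t = r
    · subst ht; simp [φ]
    · simp [φ, ht]
  have hneg : ∀ x, soloParity U (φ x) = - soloParity U x := by
    intro x
    unfold soloParity
    rw [Finset.prod_eq_mul_prod_sdiff_singleton_of_mem hr,
      Finset.prod_eq_mul_prod_sdiff_singleton_of_mem hr (fun t => soloSign (x t))]
    have h1 : ∀ t ∈ U \ {r}, soloSign (φ x t) = soloSign (x t) := by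
      intro t ht
      have : t ≠ r := by simpa using (Finset.mem_sdiff.1 ht).2
      simp [φ, this]
    rw [Finset.prod_congr rfl h1]
    simp [φ]
  have hsum := Equiv.sum_comp hinv.toPerm (soloParity U)
  simp only [Function.Involutive.coe_toPerm, hneg, Finset.sum_neg_distrib] at hsum
  linear_combination (-1/2 : ℂ) * hsum

/-- Orthogonality of parities. -/
theorem solo_sum_parity_mul (S T : Finset (Fin n)) :
    ∑ x : Fin n → Bool, soloParity S x * soloParity T x = if S = T then (2 : ℂ) ^ n else 0 := by
  classical
  split_ifs with hST
  · subst hST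
    simp [soloParity_mul_self]
  · simp_rw [soloParity_mul]
    apply solo_sum_parity_eq_zero
    rw [Finset.nonempty_iff_ne_empty]
    intro h0
    rw [Finset.union_eq_empty, Finset.sdiff_eq_empty_iff_subset,
      Finset.sdiff_eq_empty_iff_subset] at h0
    exact hST (Finset.Subset.antisymm h0.1 h0.2)

/-- Distinct parities are linearly independent over `ℂ`. -/
theorem solo_linearIndependent_parity {m : ℕ} {S : Fin m → Finset (Fin n)}
    (hS : Function.Injective S) : LinearIndependent ℂ (fun i => soloParity (S i)) := by
  classical
  rw [linearIndependent_iff']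
  intro t g hg j hj
  have key := congr_arg (fun F : (Fin n → Bool) → ℂ => ∑ x, F x * soloParity (S j) x) hg
  simp only [Finset.sum_apply, Pi.smul_apply, smul_eq_mul, Finset.sum_mul, Pi.zero_apply,
    zero_mul, Finset.sum_const_zero] at key
  rw [Finset.sum_comm] at key
  simp_rw [mul_assoc, ← Finset.mul_sum, solo_sum_parity_mul, hS.eq_iff] at key
  simp only [mul_ite, mul_zero, Finset.sum_ite_eq', hj, if_true] at key
  have h2 : (2 : ℂ) ^ n ≠ 0 := pow_ne_zero _ two_ne_zero
  exact (mul_eq_zero.1 key).resolve_right h2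

end Parity

/-- Members of a `(K, h)`-design with `K ≥ 2`, `h ≥ 1` are pairwise distinct. -/
theorem solo_design_injective {K h m n : ℕ} (hK : 2 ≤ K) (hh : 1 ≤ h) (S : SoloDesign K h m n) :
    Function.Injective S.S := by
  classical
  intro i j hij
  by_contra hne
  let c : Fin m → ℤ := fun l => (if l = i then 1 else 0) - (if l = j then 1 else 0)
  have hci : c i = 1 := by simp [c, hne]
  have hsupp : (univ.filter fun l => c l ≠ 0) ⊆ {i, j} := by
    intro l hl
    simp only [Finset.mem_filter, Finset.mem_univ, true_and, c] at hl
    simp only [Finset.mem_insert, Finset.mem_singleton]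
    by_contra hl'
    push Not at hl'
    exact hl (by simp [hl'.1, hl'.2])
  have hcard : (univ.filter fun l => c l ≠ 0).card ≤ K :=
    (Finset.card_le_card hsupp).trans ((Finset.card_insert_le _ _).trans (by simpa using hK))
  have habs : ∀ l, |c l| ≤ h := by
    intro l
    simp only [c]
    split_ifs <;> simp <;> omega
  have hsum : ∀ r : Fin n, (∑ l, if r ∈ S.S l then c l else 0) = 0 := by
    intro r
    have h1 : ∀ l, (if r ∈ S.S l then c l else 0)
        = (if l = i then (if r ∈ S.S l then (1 : ℤ) else 0) else 0)
          - (if l = j then (if r ∈ S.S l then (1 : ℤ) else 0) else 0) := by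
      intro l; simp only [c]; split_ifs <;> simp
    simp_rw [h1, Finset.sum_sub_distrib, Finset.sum_ite_eq', Finset.mem_univ, if_true, hij,
      sub_self]
  have := S.indep c hcard habs hsum i
  simp [hci] at this

/-- **The trivial bound.** If the `m` parities of a design (`K ≥ 2`, `h ≥ 1`) lie in the quadratic
span of `s` functions on the cube, then `m ≤ dim_ℂ ℂ[y_1, …, y_s]_{≤ 2}` (`= C(s+2, 2)`): the
parities are linearly independent and lie in the image of the evaluation map
`Γ ↦ (x ↦ Γ(v(x)))` restricted to polynomials of total degree `≤ 2`. -/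
theorem solo_card_le_finrank_of_quadSpan {K h m n s : ℕ} (hK : 2 ≤ K) (hh : 1 ≤ h)
    (S : SoloDesign K h m n) (v : (Fin n → Bool) → Fin s → ℂ)
    (hΓ : ∀ i : Fin m, ∃ Γ : MvPolynomial (Fin s) ℂ, Γ.totalDegree ≤ 2 ∧
      ∀ x : Fin n → Bool, eval (v x) Γ = soloParity (S.S i) x) :
    m ≤ Module.finrank ℂ (restrictTotalDegree (Fin s) ℂ 2) := by
  classical
  choose Γ hdeg hev using hΓ
  let ev : MvPolynomial (Fin s) ℂ →ₗ[ℂ] ((Fin n → Bool) → ℂ) :=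
    LinearMap.pi fun x => (MvPolynomial.aeval (v x)).toLinearMap
  let f := ev.domRestrict (restrictTotalDegree (Fin s) ℂ 2)
  have hmem : ∀ i, Γ i ∈ restrictTotalDegree (Fin s) ℂ 2 := fun i =>
    (mem_restrictTotalDegree _ _ _).2 (hdeg i)
  have hfi : ∀ i, f ⟨Γ i, hmem i⟩ = soloParity (S.S i) := by
    intro i; funext x
    simp [f, ev, hev i x]
  let q : Fin m → LinearMap.range f := fun i => ⟨soloParity (S.S i), ⟨Γ i, hmem i⟩, hfi i⟩
  have hq : LinearIndependent ℂ q := by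
    apply LinearIndependent.of_comp (LinearMap.range f).subtype
    exact solo_linearIndependent_parity (solo_design_injective hK hh S)
  calc m = Fintype.card (Fin m) := (Fintype.card_fin m).symm
    _ ≤ Module.finrank ℂ (LinearMap.range f) := hq.fintype_card_le_finrank
    _ ≤ Module.finrank ℂ (restrictTotalDegree (Fin s) ℂ 2) := LinearMap.finrank_range_le f

/-- Stars and bars for degree `≤ 2`: `dim_ℂ ℂ[y_1, …, y_s]_{≤ 2} ≤ C(s+2, 2)` (pad a monomial of
degree `≤ 2` with a slack variable to a multiset of size exactly `2` over `Option (Fin s)`). -/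
theorem solo_finrank_restrictTotalDegree_two_le (s : ℕ) :
    Module.finrank ℂ (restrictTotalDegree (Fin s) ℂ 2) ≤ Nat.choose (s + 2) 2 := by
  classical
  let T : Set (Fin s →₀ ℕ) := {μ | (μ.sum fun _ e => e) ≤ 2}
  have hfr : Module.finrank ℂ (restrictTotalDegree (Fin s) ℂ 2) = Nat.card T :=
    Module.finrank_eq_nat_card_basis (basisRestrictSupport ℂ T)
  -- the padding map `T → Sym (Option (Fin s)) 2`
  have hdeg : ∀ μ : T, Multiset.card (Finsupp.toMultiset μ.1) ≤ 2 := by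
    intro μ
    rw [Finsupp.card_toMultiset]
    exact μ.2
  let pad : T → Sym (Option (Fin s)) 2 := fun μ =>
    Sym.mk ((Finsupp.toMultiset μ.1).map some + Multiset.replicate (2 - Multiset.card
      (Finsupp.toMultiset μ.1)) none) (by
        rw [Multiset.card_add, Multiset.card_map, Multiset.card_replicate]
        have := hdeg μ
        omega)
  have hrep : ∀ k, Multiset.filterMap id (Multiset.replicate k (none : Option (Fin s))) = 0 := by
    intro k
    induction k with
    | zero => simp
    | succ k ih => rw [Multiset.replicate_succ, Multiset.filterMap_cons_none _ _ rfl, ih]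
  have hback : ∀ μ : T, Multiset.filterMap id ((pad μ : Sym (Option (Fin s)) 2) : Multiset
      (Option (Fin s))) = Finsupp.toMultiset μ.1 := by
    intro μ
    simp only [pad, Sym.coe_mk, Multiset.filterMap_add, Multiset.filterMap_map, hrep, add_zero]
    exact Multiset.filterMap_some _
  have hinj : Function.Injective pad := by
    intro μ μ' hμ
    have h1 := hback μ
    rw [hμ, hback μ'] at h1
    apply Subtype.ext
    have h2 := congr_arg Multiset.toFinsupp h1
    simpa [Finsupp.toMultiset_toFinsupp] using h2.symm
  have hcard := Nat.card_le_card_of_injective pad hinj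
  rw [Nat.card_eq_fintype_card (α := Sym (Option (Fin s)) 2), Sym.card_sym_eq_choose,
    Fintype.card_option, Fintype.card_fin, show s + 1 + 2 - 1 = s + 2 by omega] at hcard
  rw [hfr]
  exact hcard

/-- **Non-vacuity of `SoloBoolQuadSpanBound`.** For `K ≥ 2`, `h ≥ 1` the structure is inhabited
with `Q s = C(s+2, 2)` (`≥ dim_ℂ ℂ[y_1, …, y_s]_{≤ 2}`; the trivial bound).  The summit-relevant
conjecture Q^𝔹 asks for `Q s = O(s^γ)` with `γ < 3/2`; "sumset" examples force `γ ≥ 4/3`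
already for `K = 6, 7`. -/
def soloInformed_boolQuadSpanBound_trivial {K h : ℕ} (hK : 2 ≤ K) (hh : 1 ≤ h) :
    SoloBoolQuadSpanBound K h where
  Q s := Nat.choose (s + 2) 2
  bound _ _ s S v hΓ :=
    (solo_card_le_finrank_of_quadSpan hK hh S v hΓ).trans (solo_finrank_restrictTotalDegree_two_le s)

/-- `SoloBoolQuadSpanBound K h` is inhabited for `K ≥ 2`, `h ≥ 1`. -/
theorem soloInformed_nonempty_boolQuadSpanBound {K h : ℕ} (hK : 2 ≤ K) (hh : 1 ≤ h) :
    Nonempty (SoloBoolQuadSpanBound K h) :=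
  ⟨soloInformed_boolQuadSpanBound_trivial hK hh⟩

end Summit.ValiantsHypothesis.ValiantsHypothesis.Theorems
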